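import Mathlib
import HarnessLib
import HarnessLib.Audit
import Summits.Langlands.Statement
import Summits.Langlands.Langlands.Theses.GenuineTorsionSplit
import Summits.Langlands.Langlands.Theorems.LevelOneDyadicCharZero
import Literature.NumberTheory.Automorphic.ResGLnCohomology

/-!
# Dyadic reciprocity, part 17 «Classical» — the kernels of the lens-4 g20 node `ClassicalCongruenceSplit`
(cell decomp-langlands; target GZ = `GenuineTorsionSplit.GenuineTorsionAutomorphy`, stmt-Langlands-27089).

GZ ⟸ S2T ∧ CJ ∧ WL, PROVED (`gz_of_pieces`): a genuinely-torsion dyadic Hecke eigensystem is still congruent to a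
PARALLEL-WEIGHT classical eigenclass (Scholze 2015 Thm IV.3.1 — torsion classicality modulo nilpotence, valid at
every prime — here S2T `DyadicTowerClassicalRelations`, the `p = 2` slot, with `∀ J ∃ N`, of the schema whose
`p ≥ 5` slots are the vendored fact `BigHeckeGLn.Scholze2015_gl2TowerHeckeRelations_classical`:
`dyadic_iff_schema`, `schema_of_vendoredText`), the residue-field POINT of the torsion Hecke algebra kills every
classical relation (`point_kills_of_pow_eq_zero`: `ψ(Q)^N = ψ(Q^N) = 0` in a field), a Deligne–Serre junction
CJ `ClassicalCongruenceJunction` lifts the point to the `ℤ̄₂`-eigenvalues of a non-zero classical eigenclass,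
and WL `WeightedLiftableAutomorphy` (GZ's box with a classical receptacle avatar of any weight/level ⟹ the
lineage TAIL; S-implied: `wl_of_langlands`; discharged modulo the print fact ESW `WeightedEichlerShimuraHarder`
by `wl_of_weightedEichlerShimura`, through the landed junction `Transit.residuallyAutomorphic_of_assoc`)
concludes.  The `¬CZ` hypothesis of GZ is not used.  Upward: `closes` / `closes_print2` reach `Langlands` over
the host chain `CharZero.closes` (LZ, TP, FRAME⁵); `defectZero_of_pieces(_print)` reach TZ 26851.
Memo, probes, route vehicle: `run/shared/lean/pub/decomp-langlands/nodes/lens-4-g20-ClassicalCongruenceSplit.*`.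
Companions in the tree: `Theorems/LevelOneDyadicTransit.lean`, `Theorems/LevelOneDyadicCharZero.lean`.
-/

set_option linter.dupNamespace false
set_option linter.unusedVariables false
set_option linter.unusedSectionVars false

namespace Summit.Langlands.Langlands.Theorems.LevelOneDyadic.Classical

open scoped NumberField
open Filter IsDedekindDomain Polynomial
open Literature.NumberTheory.GaloisRepresentations Literature.NumberTheory.Automorphic
open Literature.NumberTheory.Automorphic.BigHeckeGLn
open Summit.Langlands.Langlands.Theses
open Summit.Langlands.Langlands.Theorems.LevelOneDyadic

/-! ## The three pieces -/

/-- crux (rank 2) · RESIDUAL · VENDORABLE — **S2T, dyadic tower relations are classical modulo nilpotence**: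
the `p = 2` member, for the `GL₂/F` tower of a totally real `F` and any tame datum `𝒰 : TameLevel 2 F 2`, of the
schema whose `p ≥ 5`, `p ∤ disc F` members are the vendored named fact
`BigHeckeGLn.Scholze2015_gl2TowerHeckeRelations_classical` (relation currency: integer non-commutative
polynomials `Q ∈ ℤ⟨X_1,…,X_r⟩` in good letters `T_{v,i}` vanishing on finitely many PARALLEL-weight classical
receptacles `H^{q_k}(S_{K_f(𝔫·2^e)}, Ẽ_{λ_k}(ℚ̄₂))` act nilpotently, exponent `N = N(J) ≥ 1`, on the torsion
modules `H^i(X_{U_r}, ℤ/2^s)`, `(r,s,i) ∈ J`).  Why it might fail: only if the `p = 2` bookkeeping of the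
`GL₂/F` tower (2-group Hochschild–Serre filtrations replacing the prime-to-`p` idempotents of steps (a), (c),
(d) of the vendored docstring) hid a non-nilpotent defect — Scholze's Thm. IV.3.1 itself has no hypothesis on
`p`.  Sources: Scholze2015 Thm. IV.3.1, Rem. V.4.6, Cor. V.2.6 (proof); CaraianiTamiozzo2023 §2.2 Remark;
EmertonReduzziXiao2017 §2.1; tree `GL2TowerTorsionRelationsClassical.lean`. -/
def DyadicTowerClassicalRelations : Prop :=
  ∀ (F : Type) [Field F] [NumberField F], NumberField.IsTotallyReal F → ∀ (𝒰 : Literature.NumberTheory.Automorphic.BigHeckeGLn.TameLevel 2 F 2), ∃ 𝔫 : Ideal (NumberField.RingOfIntegers F), 𝔫 ≠ 0 ∧ ∀ J : Finset (ℕ × ℕ × ℕ), ∃ (N e m : ℕ) (lams : Fin m → (F →+* PadicAlgCl 2) → Fin 2 → ℤ) (qs : Fin m → ℕ), 0 < N ∧ (∀ (k : Fin m) (σ σ' : F →+* PadicAlgCl 2), lams k σ = lams k σ') ∧ ∀ (r : ℕ) (ix : Fin r → IsDedekindDomain.HeightOneSpectrum (NumberField.RingOfIntegers F) × ℕ), (∀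 j, (ix j).1 ∉ 𝒰.bad ∧ ¬ (ix j).1.asIdeal ∣ 𝔫 * Ideal.span {((2 : ℕ) : NumberField.RingOfIntegers F)} ^ e) → ∀ Q : FreeRing (Fin r), (∀ k : Fin m, FreeRing.lift (fun j => Literature.NumberTheory.Automorphic.ResGLnCohomology.heckeT (PadicAlgCl 2) 2 F (𝔫 * Ideal.span {((2 : ℕ) : NumberField.RingOfIntegers F)} ^ e) (lams k) (qs k) (ix j).1 (ix j).2) Q = 0) → ∀ idx ∈ J, (FreeRing.lift (fun j => 𝒰.heckeOperator (Literature.NumberTheory.Automorphic.BigHeckeGLn.heckeElement 2 F (ix j).1 (ix j).2)) Q ^ N) idx = 0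

/-- support (rank 9) · VENDORABLE∣ATTACKABLE — **CJ, relations lift to a congruent classical eigenclass**
(any prime `p`, any number field `F`, `GL₂` receptacles, level `𝔫 ≠ 0`): if a residue-field letter assignment
`f : (v, i) ↦ f(v,i) ∈ 𝔽̄_p` kills (under `FreeRing.lift`) every integer non-commutative polynomial in good
letters (`v ∉ S`, `v ∤ 𝔫`) that vanishes on every receptacle `H^{q_k}(S_{K_f(𝔫)}, Ẽ_{λ_k}(ℚ̄_p))` of a finite
PARALLEL-weight family — i.e. `f` is a CHARACTER `𝕋_ℤ → 𝔽̄_p` of the integer Hecke algebra `𝕋_ℤ` of the family —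
then some receptacle carries a non-zero simultaneous `T_{v,i}`-eigenclass with `ℤ̄_p`-valued eigenvalues
`a(v,i)` reducing to `f(v,i)` at all good letters.  This is the Deligne–Serre lifting lemma in Hecke-algebra
form («every maximal ideal of 𝕋_ℤ lies above a minimal prime = a characteristic-0 eigensystem; realise it
through an embedding matching the maximal ideal», or `p`-adically: `𝕋_ℤ ⊗ 𝒪_{ℂ_p}` is finite free over the
henselian `𝒪_{ℂ_p}`, so its local factor at `ker f` has a `ℂ_p`-point, integral, occurring by faithfulness),
resting on three standard inputs about the receptacle MODEL: (i) `dim H^q(S_{K_f(𝔫)}, Ẽ_λ) < ∞`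
[Borel–Serre; Raghunathan], (ii) `𝕋_ℤ` is a finitely generated `ℤ`-module (Betti lattice `Ẽ_{λ,ℤ}`; with the
tree's rationality fact `ResGLnCohomology.heckeRelations_definedOverInt` giving `𝕋_ℤ ⊗ 𝒪 ↪ ∏ End`), (iii) the
good `T_{v,i}` (all `i`: `t_{v,0} = 1`, `t_{v,i≥2}` central) pairwise commute (spherical Hecke algebras).
Why it might fail AS TYPED: only through a junk convention of the receptacle model `TwistedQuotient.cohomology`
violating (i)–(iii) in a degenerate parameter (non-dominant `λ` gives the zero receptacle — harmless; `𝔫 = 0` is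
excluded).  NOT S-implied (algebra).  Sources: DeligneSerre1974 Lemme 6.11; Clozel1990 §3.5 (p. 122–123);
GrobnerRaghuram2014 §7 Lemmas 37–38; BorelSerre1973 §11; tree `ResGLnCohomologyRationalRelations.lean`; Mathlib
`Module.End.exists_eigenvector`-type lemmas, `Ideal.exists_ideal_over_maximal_of_isIntegral`,
`Ideal.exists_minimalPrimes_le`. -/
def ClassicalCongruenceJunction : Prop :=
  ∀ (p : ℕ) [Fact p.Prime] (F : Type) [Field F] [NumberField F] (S : Set (IsDedekindDomain.HeightOneSpectrum (NumberField.RingOfIntegers F))) (𝔫 : Ideal (NumberField.RingOfIntegers F)) (m : ℕ) (lams : Fin m → (F →+* PadicAlgCl p) → Fin 2 → ℤ) (qs : Fin m → ℕ), 𝔫 ≠ 0 → (∀ (k : Fin m) (σ σ' : F →+* PadicAlgCl p), lams k σ = lams k σ') → ∀ (f : IsDedekindDomain.HeightOneSpectrum (NumberField.RingOfIntegers F) → ℕ → Literature.NumberTheory.GaloisRepresentations.padicAlgClResidueField p), (∀ (r : ℕ) (ix : Fin r → IsDedekindDomain.HeightOneSpectrum (NumberField.RingOfIntegers F) × ℕ),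 (∀ j, (ix j).1 ∉ S ∧ ¬ (ix j).1.asIdeal ∣ 𝔫) → ∀ Q : FreeRing (Fin r), (∀ k : Fin m, FreeRing.lift (fun j => Literature.NumberTheory.Automorphic.ResGLnCohomology.heckeT (PadicAlgCl p) 2 F 𝔫 (lams k) (qs k) (ix j).1 (ix j).2) Q = 0) → FreeRing.lift (fun j => f (ix j).1 (ix j).2) Q = 0) → ∃ (k : Fin m) (a : IsDedekindDomain.HeightOneSpectrum (NumberField.RingOfIntegers F) → ℕ → (Valued.v : Valuation (PadicAlgCl p) NNReal).valuationSubring) (c : Literature.NumberTheory.Automorphic.ResGLnCohomology.levelCohomology (PadicAlgCl p) 2 F 𝔫 (lams k) (qs k)), c ≠ 0 ∧ ∀ v, v ∉ S → ¬ v.asIdeal ∣ 𝔫 → ∀ i : ℕ, Literature.NumberTheory.Automorphic.ResGLnCohomology.heckeT (PadicAlgCl p) 2 F 𝔫 (lams k) (qs k) v i c = ((a v i : (Valued.v : Valuation (PadicAlgCl p) NNReal).valuationSubring) : PadicAlgCl p) • c ∧ IsLocalRing.residue (Valued.v : Valuation (PadicAlgCl p) NNReal).valuationSubring (a v i) = f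 v i

/-- crux (rank 3) · ATTACKABLE∣PRINT · S-implied — **WL, parallel-weight liftable ⟹ residually automorphic**:
GZ's box verbatim (irreducible 2-adic `ρ` over totally real `K`, `n = 2`, insoluble non-Artin-liftable residue,
pinned-geometric, HT-regular, unramified outside `2`) with the pair (torsion avatar, ¬CZ) replaced by a CLASSICAL
RECEPTACLE AVATAR: a finite `S`, a level `𝔫 ≠ 0`, a weight `λ`, a degree `q`, a reduction `τ̄` of `ρ`, and a
non-zero simultaneous eigenclass `c ∈ H^q(S_{K_f(𝔫)}, Ẽ_λ(ℚ̄₂))` (`ResGLnCohomology.levelCohomology`) with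
`ℤ̄₂`-valued eigenvalues off `S` whose reduction is associated with `τ̄`; conclusion = the lineage TAIL.  The
weight-`λ` twin of LZ.  Why it might fail: it cannot mathematically (Harder 1987: cuspidal or Eisenstein;
Eisenstein excluded by insolubility via Brauer–Nesbitt; cuspidal ⟹ π by Eichler–Shimura–Harder; then the landed
engine `Transit.residuallyAutomorphic_of_assoc`) — AS TYPED it fails only if the receptacle's `heckeT`
normalisation (`q_v^{i(n−i)/2} e_i`) mismatched `heckeFrobPoly` (the grounder's check, as for ES at g19).
Sources: Harder1987 §4.2 Thm. 2; Clozel1990 Lemme 3.15; tree `ResGL2EigensystemCuspidalOrEisenstein.lean`,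
`Theorems/LevelOneDyadicTransit.lean`. -/
def WeightedLiftableAutomorphy : Prop :=
  ∀ (K : Type) [Field K] [NumberField K] (n : ℕ) (hcpt : Literature.NumberTheory.Automorphic.isCompact_glFiniteIntegralLevel n K), 0 < n → ∀ (ι : PadicAlgCl 2 ≃+* ℂ) (ρ : Literature.NumberTheory.GaloisRepresentations.FramedGaloisRep K (PadicAlgCl 2) n), ρ.toGaloisRep.IsIrreducible → (∀ τ : Field.absoluteGaloisGroup K →* GL (Fin n) (Literature.NumberTheory.GaloisRepresentations.padicAlgClResidueField 2), ρ.IsResidualRepOf (RingHom.id (Literature.NumberTheory.GaloisRepresentations.padicAlgClResidueField 2)) τ → ¬ IsSolvable τ.range) → ¬ (∃ (σ : Literature.NumberTheory.GaloisRepresentations.FramedGaloisRep K (PadicAlgCl 2) n) (τ : Field.absoluteGaloisGroup K →* GL (Fin n) (Literature.NumberTheory.GaloisRepresentations.padicAlgClResidueField 2)), (Set.range (fun g : Field.absoluteGaloisGroup K => σ g)).Finite ∧ σ.toGaloisRep.IsIrreducible ∧ ρ.IsResidualRepOf (RingHom.id (Literature.NumberTheory.GaloisRepresentations.padicAlgClResidueField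 2)) τ ∧ σ.IsResidualRepOf (RingHom.id (Literature.NumberTheory.GaloisRepresentations.padicAlgClResidueField 2)) τ) → ((∀ᶠ v : IsDedekindDomain.HeightOneSpectrum (NumberField.RingOfIntegers K) in cofinite, ρ.IsUnramifiedAt v) ∧ ∀ (v : IsDedekindDomain.HeightOneSpectrum (NumberField.RingOfIntegers K)) (hv : ((2 : ℕ) : NumberField.RingOfIntegers K) ∈ v.asIdeal), (Literature.NumberTheory.PAdicHodge.fontainePstAdicCompletion v 2 hv).IsDeRhamFramed (ρ.toLocal v)) → (∀ (v : IsDedekindDomain.HeightOneSpectrum (NumberField.RingOfIntegers K)) (hv : ((2 : ℕ) : NumberField.RingOfIntegers K) ∈ v.asIdeal), ∀ e : v.adicCompletion K →+* PadicAlgCl 2, Continuous e → (ρ.labelledHodgeTateWeightsAt v (Literature.NumberTheory.PAdicHodge.fontainePstAdicCompletion v 2 hv).algebra (Literature.NumberTheory.PAdicHodge.fontainePstAdicCompletion v 2 hv).𝔅 e).Nodup) → (∀ v : IsDedekindDomain.HeightOneSpectrum (NumberField.RingOfIntegers K), ((2 : ℕ) : NumberField.RingOfIntegers K) ∉ v.asIdeal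 → ρ.IsUnramifiedAt v) → (n = 2 ∧ NumberField.IsTotallyReal K) → (letI : TopologicalSpace (Literature.NumberTheory.GaloisRepresentations.padicAlgClResidueField 2) := ⊥; ∃ (S : Set (IsDedekindDomain.HeightOneSpectrum (NumberField.RingOfIntegers K))), S.Finite ∧ ∃ (𝔫 : Ideal (NumberField.RingOfIntegers K)), 𝔫 ≠ 0 ∧ ∃ (lam : (K →+* PadicAlgCl 2) → Fin n → ℤ) (q : ℕ) (τ : Literature.NumberTheory.GaloisRepresentations.FramedGaloisRep K (Literature.NumberTheory.GaloisRepresentations.padicAlgClResidueField 2) n) (a : IsDedekindDomain.HeightOneSpectrum (NumberField.RingOfIntegers K) → ℕ → (Valued.v : Valuation (PadicAlgCl 2) NNReal).valuationSubring) (c : Literature.NumberTheory.Automorphic.ResGLnCohomology.levelCohomology (PadicAlgCl 2) n K 𝔫 lam q), ρ.IsReductionOf (RingHom.id (Literature.NumberTheory.GaloisRepresentations.padicAlgClResidueField 2)) (τ : Field.absoluteGaloisGroup K →* GL (Fin n) (Literature.NumberTheory.GaloisRepresentations.padicAlgClResidueField 2)) ∧ c ≠ 0 ∧ (∀ v ∉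 S, ∀ j : ℕ, Literature.NumberTheory.Automorphic.ResGLnCohomology.heckeT (PadicAlgCl 2) n K 𝔫 lam q v j c = ((a v j : (Valued.v : Valuation (PadicAlgCl 2) NNReal).valuationSubring) : PadicAlgCl 2) • c) ∧ Literature.NumberTheory.Automorphic.BigHeckeGLn.IsAssociatedFamily n S (fun v j => IsLocalRing.residue (Valued.v : Valuation (PadicAlgCl 2) NNReal).valuationSubring (a v j)) τ) → ∃ π : Literature.NumberTheory.Automorphic.CuspidalAutomorphicRepData n K hcpt, π.1.IsLAlgebraic ∧ ∀ᶠ v : IsDedekindDomain.HeightOneSpectrum (NumberField.RingOfIntegers K) in cofinite, ρ.IsUnramifiedAt v ∧ (∃ α : Multiset ℂ, π.1.HasSatakeParamAt v α) ∧ ∀ α : Multiset ℂ, π.1.HasSatakeParamAt v α → ∃ P Q : Polynomial (Valued.v : Valuation (PadicAlgCl 2) NNReal).valuationSubring, ρ.HasFrobCharpolyAt v (P.map (Valued.v : Valuation (PadicAlgCl 2) NNReal).valuationSubring.subtype) ∧ Literature.NumberTheory.Automorphic.arithFrobPolyOfSatake ι v.residueCard 1 α = Q.map (Valued.v : Valuation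 (PadicAlgCl 2) NNReal).valuationSubring.subtype ∧ P.map (IsLocalRing.residue (Valued.v : Valuation (PadicAlgCl 2) NNReal).valuationSubring) = Q.map (IsLocalRing.residue (Valued.v : Valuation (PadicAlgCl 2) NNReal).valuationSubring)

/-- assembly — the node: GZ from the three pieces. -/
def Assembly : Prop :=
  DyadicTowerClassicalRelations → ClassicalCongruenceJunction → WeightedLiftableAutomorphy →
    GenuineTorsionSplit.GenuineTorsionAutomorphy

/-! ## Kernel 0 — the finite-level Hecke algebra of the tower in relation currency -/

section Tower

variable {n : ℕ} {K : Type} [Field K] [NumberField K] {p : ℕ} [Fact p.Prime]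

/-- Unfolding: for `v ∉ S`, `T_{v,i} ∈ 𝕋(U_r,s,i)` is the `idx`-component of the tower operator. [folklore] -/
theorem coe_levelHeckeT (𝒰 : TameLevel n K p) (idx : ℕ × ℕ × ℕ) {v : HeightOneSpectrum (𝓞 K)}
    (hv : v ∉ 𝒰.bad) (i : ℕ) :
    ((𝒰.levelHeckeT idx v i : 𝒰.levelHeckeSubring idx) : 𝒰.EndFactor idx) =
      𝒰.heckeOperator (heckeElement n K v i) idx := by
  classical
  rw [TameLevel.levelHeckeT, dif_neg hv]

/-- Evaluation of an integer non-commutative polynomial in letters `j ↦ T_{(ix j)}` INSIDE `𝕋(U_r,s,i)`. -/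
noncomputable def levelEval (𝒰 : TameLevel n K p) (idx : ℕ × ℕ × ℕ) {r : ℕ}
    (ix : Fin r → HeightOneSpectrum (𝓞 K) × ℕ) : FreeRing (Fin r) →+* 𝒰.levelHeckeSubring idx :=
  FreeRing.lift (fun j => 𝒰.levelHeckeT idx (ix j).1 (ix j).2)

/-- The evaluation inside `𝕋(U_r,s,i)` is the `idx`-component of the evaluation in the product ring
`∏ End(H^i(X_{U_r}, ℤ/p^s))` (good letters). [folklore] -/
theorem coe_levelEval (𝒰 : TameLevel n K p) (idx : ℕ × ℕ × ℕ) {r : ℕ}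
    (ix : Fin r → HeightOneSpectrum (𝓞 K) × ℕ) (hix : ∀ j, (ix j).1 ∉ 𝒰.bad) (Q : FreeRing (Fin r)) :
    ((levelEval 𝒰 idx ix Q : 𝒰.levelHeckeSubring idx) : 𝒰.EndFactor idx) =
      (FreeRing.lift (fun j => 𝒰.heckeOperator (heckeElement n K (ix j).1 (ix j).2)) Q) idx := by
  have hΦ : (𝒰.levelHeckeSubring idx).subtype.comp (levelEval 𝒰 idx ix) =
      (Pi.evalRingHom 𝒰.EndFactor idx).comp
        (FreeRing.lift (fun j => 𝒰.heckeOperator (heckeElement n K (ix j).1 (ix j).2))) := by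
    refine FreeRing.hom_ext fun j => ?_
    show ((levelEval 𝒰 idx ix (FreeRing.of j) : 𝒰.levelHeckeSubring idx) : 𝒰.EndFactor idx) =
      (FreeRing.lift (fun j => 𝒰.heckeOperator (heckeElement n K (ix j).1 (ix j).2)) (FreeRing.of j)) idx
    rw [levelEval, FreeRing.lift_of, FreeRing.lift_of]
    exact coe_levelHeckeT 𝒰 idx (hix j) (ix j).2
  exact RingHom.congr_fun hΦ Q

/-- **RELATIONS TO POINTS.**  A residue-field (indeed any field-valued) point `ψ` of the finite-level Hecke
algebra `𝕋(U_r,s,i)` kills every integer non-commutative polynomial in good letters whose tower image has a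
vanishing `N`-th power (`N ≥ 1`) at `idx`: `ψ(Q)^N = ψ(Q^N) = 0` in a field.  This is the bridge from the
relation currency of Scholze's theorem to the avatar `ψ` of GZ. [folklore] -/
theorem point_kills_of_pow_eq_zero (𝒰 : TameLevel n K p) (idx : ℕ × ℕ × ℕ) {k : Type*} [Field k]
    (ψ : 𝒰.levelHeckeSubring idx →+* k) {r : ℕ} (ix : Fin r → HeightOneSpectrum (𝓞 K) × ℕ)
    (hix : ∀ j, (ix j).1 ∉ 𝒰.bad) (Q : FreeRing (Fin r)) {N : ℕ} (hN : 0 < N)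
    (h0 : (FreeRing.lift (fun j => 𝒰.heckeOperator (heckeElement n K (ix j).1 (ix j).2)) Q ^ N) idx = 0) :
    FreeRing.lift (fun j => ψ (𝒰.levelHeckeT idx (ix j).1 (ix j).2)) Q = 0 := by
  have hpow : levelEval 𝒰 idx ix Q ^ N = 0 := by
    apply Subtype.ext
    show ((levelEval 𝒰 idx ix Q ^ N : 𝒰.levelHeckeSubring idx) : 𝒰.EndFactor idx) =
      ((0 : 𝒰.levelHeckeSubring idx) : 𝒰.EndFactor idx)
    rw [SubmonoidClass.coe_pow, coe_levelEval 𝒰 idx ix hix Q, ← Pi.pow_apply, h0]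
    rfl
  have hψ : ψ (levelEval 𝒰 idx ix Q) = 0 := by
    have h := congrArg ψ hpow
    rw [map_pow, map_zero] at h
    exact (pow_eq_zero_iff hN.ne').mp h
  have hfe : FreeRing.lift (fun j => ψ (𝒰.levelHeckeT idx (ix j).1 (ix j).2)) =
      ψ.comp (levelEval 𝒰 idx ix) := by
    refine FreeRing.hom_ext fun j => ?_
    show FreeRing.lift (fun j => ψ (𝒰.levelHeckeT idx (ix j).1 (ix j).2)) (FreeRing.of j) =
      ψ (levelEval 𝒰 idx ix (FreeRing.of j))
    rw [levelEval, FreeRing.lift_of, FreeRing.lift_of]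
  rw [hfe]
  exact hψ

end Tower

/-! ## Kernel I — THE NODE: GZ ⟸ S2T ∧ CJ ∧ WL -/

/-- **GZ from the three pieces.**  Given a box `ρ` with torsion avatar `ψ` at index `idx` of the full-tame
`2`-tower: S2T (with `J = {idx}`) gives the auxiliary level `𝔫·2^e`, the exponent `N` and the parallel
family of classical receptacles; `point_kills_of_pow_eq_zero` turns nilpotence into «`ψ` kills every classical
relation»; CJ produces a receptacle `k`, a non-zero simultaneous eigenclass `c` and `ℤ̄₂`-eigenvalues `a`
reducing to `ψ(T_{v,i})` off `S' = S ∪ {v ∣ 𝔫·2^e}`; association with `τ̄` transfers along `a ≡ ψ`; WL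
concludes.  The ¬CZ hypothesis of GZ is NOT used (genuine torsion is interpolated in higher parallel weight).
0 sorry. [kernel certificate] -/
theorem gz_of_pieces (hS : DyadicTowerClassicalRelations) (hC : ClassicalCongruenceJunction)
    (hW : WeightedLiftableAutomorphy) : GenuineTorsionSplit.GenuineTorsionAutomorphy := by
  intro K _ _ n hcpt hn ι ρ hirr hins hnl hgeo hreg hlvl hd hav hncz
  obtain ⟨hn2, hTR⟩ := hd
  subst hn2
  letI : TopologicalSpace (padicAlgClResidueField 2) := ⊥
  obtain ⟨idx, τ, hρτ, ψ, hψ⟩ := hav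
  obtain ⟨𝔫, h𝔫, hJ⟩ := hS K hTR (TameLevel.full 2 K 2)
  obtain ⟨N, e, m, lams, qs, hN, hpar, hrel⟩ := hJ {idx}
  have h2 : Ideal.span {((2 : ℕ) : 𝓞 K)} ≠ 0 := by
    rw [Ne, Ideal.zero_eq_bot, Ideal.span_singleton_eq_bot]
    exact Nat.cast_ne_zero.mpr two_ne_zero
  have h𝔫' : 𝔫 * Ideal.span {((2 : ℕ) : 𝓞 K)} ^ e ≠ 0 := mul_ne_zero h𝔫 (pow_ne_zero _ h2)
  obtain ⟨k, a, c, hc, hac⟩ := hC 2 K (TameLevel.full 2 K 2).bad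
    (𝔫 * Ideal.span {((2 : ℕ) : 𝓞 K)} ^ e) m lams qs h𝔫' hpar
    (fun v j => ψ ((TameLevel.full 2 K 2).levelHeckeT idx v j))
    (fun r ix hix Q hQ => point_kills_of_pow_eq_zero (TameLevel.full 2 K 2) idx ψ ix
      (fun j => (hix j).1) Q hN (hrel r ix hix Q hQ idx (Finset.mem_singleton_self idx)))
  refine hW K 2 hcpt hn ι ρ hirr hins hnl hgeo hreg hlvl ⟨rfl, hTR⟩ ?_
  refine ⟨(TameLevel.full 2 K 2).bad ∪ {v | v.asIdeal ∣ 𝔫 * Ideal.span {((2 : ℕ) : 𝓞 K)} ^ e}, ?_,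
    𝔫 * Ideal.span {((2 : ℕ) : 𝓞 K)} ^ e, h𝔫', lams k, qs k, τ, a, c, hρτ, hc, ?_, ?_⟩
  · exact (TameLevel.full 2 K 2).bad_finite.union (Ideal.finite_factors h𝔫')
  · intro v hv j
    simp only [Set.mem_union, Set.mem_setOf_eq, not_or] at hv
    exact (hac v hv.1 hv.2 j).1
  · intro v hv
    simp only [Set.mem_union, Set.mem_setOf_eq, not_or] at hv
    obtain ⟨hunr, hchar⟩ := hψ v hv.1
    refine ⟨hunr, ?_⟩
    have hfun : (fun j => IsLocalRing.residue (padicAlgClIntegers 2) (a v j)) =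
        fun j => ψ ((TameLevel.full 2 K 2).levelHeckeT idx v j) :=
      funext fun j => (hac v hv.1 hv.2 j).2
    show τ.HasFrobCharpolyAt v (heckeFrobPoly 2 (Ideal.absNorm v.asIdeal)
      (fun j => IsLocalRing.residue (padicAlgClIntegers 2) (a v j)))
    rw [hfun]
    exact hchar

/-- The assembly item holds outright: the node is a one-way cut, its implication PROVED. [kernel certificate] -/
theorem assembly_holds : Assembly := gz_of_pieces

/-! ## Kernel II — necessity: WL is S-implied (through B₂ = `MinimalLevelDescent.DyadicLevelOneAutomorphy`) -/

/-- B₂ ⟹ WL (the avatar hypotheses are simply dropped). [kernel certificate] -/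
theorem wl_of_dyadic (hB : MinimalLevelDescent.DyadicLevelOneAutomorphy) : WeightedLiftableAutomorphy :=
  fun K _ _ n hcpt hn ι ρ hirr _ _ hgeo _ hlvl _ _ => hB K n hcpt hn ι ρ hirr hgeo hlvl

/-- NECESSITY: Langlands ⟹ WL. [kernel certificate] -/
theorem wl_of_langlands (hLg : _root_.Langlands) : WeightedLiftableAutomorphy :=
  wl_of_dyadic (Residue.dyadic_of_langlands hLg)

/- GZ itself is S-implied: landed `CharZero.genuine_of_langlands` (composed with `genuine_route_iff_twin`
   below); so the node's only non-S-implied content is S2T ∧ CJ — print + algebra. -/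

/-! ## Kernel IIb — the discharge of WL modulo print: ESW ⟹ WL (engine junction `Transit.residuallyAutomorphic_of_assoc`) -/

/-- support (rank 9) · VENDORABLE · PRINT — **ESW, Eichler–Shimura–Harder with coefficients** (the weight-`λ` /
level-`𝔫` twin of the route's print fact ES = `CharZero.EichlerShimuraHarder`): over a totally real `K`, `n = 2`,
a non-zero simultaneous `T_{v,j}`-eigenclass `c ∈ H^q(S_{K_f(𝔫)}, Ẽ_λ(ℚ̄₂))` (`ResGLnCohomology.levelCohomology`,
eigenvalues `a(v,j) ∈ ℤ̄₂` off a finite `S`) whose reduction is associated with a reduction `τ̄` of a `ρ` all of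
whose residual representations are insoluble comes from a cuspidal L-algebraic `π` with
`arithFrobPoly(Satake_v π) = heckeFrobPoly(a_v)` for almost all `v`.  Print: Harder 1987 (§4.2 Thm. 2: the
eigensystem is cuspidal-cohomological or Eisenstein = a pair of Größencharaktere; named fact
`ResGLnCohomology.Harder1987_eigensystem_cuspidalOrEisenstein`), the Eisenstein alternative excluded because
its residual pseudo-representation is a sum of two characters (Brauer–Nesbitt + Chebotarev ⟹ `τ̄` has an
invariant line ⟹ soluble image), Clozel 1990 Lemme 3.15 (cohomological ⟺ regular algebraic), Galois
representations for Hilbert modular forms (Carayol, Taylor 1989, Blasius–Rogawski) with the L-algebraic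
half-twist (`AlgebraicityParityGL`).  Not S-implied (it produces `π` from a cohomology class).  Why it might
fail AS TYPED: the `heckeT`/`heckeFrobPoly`/`arithFrobPolyOfSatake … 1` normalisations must match at weight
`λ` exactly as they do for ES at trivial weight (the weight sits inside the eigenvalue `a(v,2)` of `T_{v,2}`). -/
def WeightedEichlerShimuraHarder : Prop :=
  ∀ (K : Type) [Field K] [NumberField K] (n : ℕ) (hcpt : Literature.NumberTheory.Automorphic.isCompact_glFiniteIntegralLevel n K), 0 < n → ∀ (ι : PadicAlgCl 2 ≃+* ℂ) (ρ : Literature.NumberTheory.GaloisRepresentations.FramedGaloisRep K (PadicAlgCl 2) n), (∀ τ : Field.absoluteGaloisGroup K →* GL (Fin n) (Literature.NumberTheory.GaloisRepresentations.padicAlgClResidueField 2), ρ.IsResidualRepOf (RingHom.id (Literature.NumberTheory.GaloisRepresentations.padicAlgClResidueField 2)) τ → ¬ IsSolvable τ.range) → (n = 2 ∧ NumberField.IsTotallyReal K) → (letI : TopologicalSpace (Literature.NumberTheory.GaloisRepresentations.padicAlgClResidueField 2) := ⊥; ∀ (S : Set (IsDedekindDomain.HeightOneSpectrum (NumberField.RingOfIntegers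 K))), S.Finite → ∀ (𝔫 : Ideal (NumberField.RingOfIntegers K)), 𝔫 ≠ 0 → ∀ (lam : (K →+* PadicAlgCl 2) → Fin n → ℤ) (q : ℕ) (τ : Literature.NumberTheory.GaloisRepresentations.FramedGaloisRep K (Literature.NumberTheory.GaloisRepresentations.padicAlgClResidueField 2) n) (a : IsDedekindDomain.HeightOneSpectrum (NumberField.RingOfIntegers K) → ℕ → (Valued.v : Valuation (PadicAlgCl 2) NNReal).valuationSubring) (c : Literature.NumberTheory.Automorphic.ResGLnCohomology.levelCohomology (PadicAlgCl 2) n K 𝔫 lam q), ρ.IsReductionOf (RingHom.id (Literature.NumberTheory.GaloisRepresentations.padicAlgClResidueField 2)) (τ : Field.absoluteGaloisGroup K →* GL (Fin n) (Literature.NumberTheory.GaloisRepresentations.padicAlgClResidueField 2)) → c ≠ 0 → (∀ v ∉ S, ∀ j : ℕ, Literature.NumberTheory.Automorphic.ResGLnCohomology.heckeT (PadicAlgCl 2) n K 𝔫 lam q v j c = ((a v j : (Valued.v : Valuation (PadicAlgCl 2) NNReal).valuationSubring) : PadicAlgCl 2) • c) → Literature.NumberTheory.Automorphic.BigHeckeGLn.IsAssociatedFamily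 n S (fun v j => IsLocalRing.residue (Valued.v : Valuation (PadicAlgCl 2) NNReal).valuationSubring (a v j)) τ → ∃ π : Literature.NumberTheory.Automorphic.CuspidalAutomorphicRepData n K hcpt, π.1.IsLAlgebraic ∧ ∀ᶠ v : IsDedekindDomain.HeightOneSpectrum (NumberField.RingOfIntegers K) in cofinite, (∃ α : Multiset ℂ, π.1.HasSatakeParamAt v α) ∧ ∀ α : Multiset ℂ, π.1.HasSatakeParamAt v α → Literature.NumberTheory.Automorphic.arithFrobPolyOfSatake ι v.residueCard 1 α = (Literature.NumberTheory.Automorphic.BigHeckeGLn.heckeFrobPoly n (Ideal.absNorm v.asIdeal) (a v)).map (Valued.v : Valuation (PadicAlgCl 2) NNReal).valuationSubring.subtype)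

/-- **WL ⟸ ESW** (the census twin M3 of `CharZero.liftable_of_eichlerShimura`): ESW hands the cuspidal
L-algebraic `π` with Satake = `heckeFrobPoly(a)` a.e.; the landed ENGINE junction
`Transit.residuallyAutomorphic_of_assoc` (p795582) turns «`τ̄` reduction of `ρ`» + «`τ̄` associated with `ā`
off the finite `S`» into the TAIL.  0 sorry. [kernel certificate] -/
theorem wl_of_weightedEichlerShimura (hE : WeightedEichlerShimuraHarder) : WeightedLiftableAutomorphy := by
  intro K _ _ n hcpt hn ι ρ hirr hins hnl hgeo hreg hlvl hd hav
  letI : TopologicalSpace (padicAlgClResidueField 2) := ⊥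
  obtain ⟨S, hS, 𝔫, h𝔫, lam, q, τ, a, c, hρτ, hc, heig, hass⟩ := hav
  obtain ⟨π, hπalg, hπ⟩ := hE K n hcpt hn ι ρ hins hd S hS 𝔫 h𝔫 lam q τ a c hρτ hc heig hass
  exact ⟨π, Transit.residuallyAutomorphic_of_assoc hcpt ι ρ τ hρτ hgeo.1 hS a hass π hπalg hπ⟩

/-- GZ MODULO PRINT + ALGEBRA: S2T ∧ CJ ∧ ESW ⟹ GZ. [kernel certificate] -/
theorem gz_of_pieces_print (hS : DyadicTowerClassicalRelations) (hC : ClassicalCongruenceJunction)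
    (hE : WeightedEichlerShimuraHarder) : GenuineTorsionSplit.GenuineTorsionAutomorphy :=
  gz_of_pieces hS hC (wl_of_weightedEichlerShimura hE)

/-! ## Kernel III — bridges to the landed twin and the deciding theorems -/

/-- The born route decl GZ (stmt-Langlands-27089) IS the landed twin's `CharZero.GenuineTorsionAutomorphy`. -/
theorem genuine_route_iff_twin :
    GenuineTorsionSplit.GenuineTorsionAutomorphy ↔ CharZero.GenuineTorsionAutomorphy := Iff.rfl

/-- The born route decl LZ (stmt-Langlands-27088) IS the landed twin's `CharZero.LiftableTorsionAutomorphy`. -/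
theorem liftable_route_iff_twin :
    GenuineTorsionSplit.LiftableTorsionAutomorphy ↔ CharZero.LiftableTorsionAutomorphy := Iff.rfl

/-- TZ 26851 ⟸ S2T ∧ CJ ∧ WL ∧ LZ (the parent crux from the node plus the liftable cell). [kernel certificate] -/
theorem defectZero_of_pieces (hS : DyadicTowerClassicalRelations) (hC : ClassicalCongruenceJunction)
    (hW : WeightedLiftableAutomorphy) (hL : GenuineTorsionSplit.LiftableTorsionAutomorphy) :
    FiniteLevelTorsionSplit.DefectZeroTorsionAutomorphy :=
  CharZero.defectZeroTorsionAutomorphy_route_iff_twin.mpr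
    (CharZero.defectZero_of_cells (liftable_route_iff_twin.mp hL)
      (genuine_route_iff_twin.mp (gz_of_pieces hS hC hW)))

/-- TZ 26851 MODULO PRINT: S2T ∧ CJ ∧ WL ∧ ES ⟹ TZ (ES = `CharZero.EichlerShimuraHarder`, LZ's print fact). -/
theorem defectZero_of_pieces_print (hS : DyadicTowerClassicalRelations) (hC : ClassicalCongruenceJunction)
    (hW : WeightedLiftableAutomorphy) (hE : CharZero.EichlerShimuraHarder) :
    FiniteLevelTorsionSplit.DefectZeroTorsionAutomorphy :=
  CharZero.defectZeroTorsionAutomorphy_route_iff_twin.mpr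
    (CharZero.defectZero_of_cells (CharZero.liftable_of_eichlerShimura hE)
      (genuine_route_iff_twin.mp (gz_of_pieces hS hC hW)))

/-- **`closes`** of the child route `ClassicalCongruenceSplit` (REFINES route-Langlands-GenuineTorsionSplit :
GenuineTorsionAutomorphy): binders S2T → CJ → WL → LZ → TP → FRAME⁵ → Langlands, pure logic through the landed
`CharZero.closes`. [kernel certificate] -/
theorem closes (hS : DyadicTowerClassicalRelations) (hC : ClassicalCongruenceJunction)
    (hW : WeightedLiftableAutomorphy) (hL : GenuineTorsionSplit.LiftableTorsionAutomorphy)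
    (hP : FiniteLevelTorsionSplit.PositiveDefectTorsionAutomorphy)
    (hF : FiniteLevelTorsionSplit.TorsionAvatarFrame) : _root_.Langlands :=
  CharZero.closes (genuine_route_iff_twin.mp (gz_of_pieces hS hC hW)) (liftable_route_iff_twin.mp hL) hP hF

/-- `closes` MODULO BOTH PRINT FACTS (S2T vendored, ES vendored) and the algebra lemma CJ: then the defect-zero
branch needs only WL (print junction M3), TP (positive defect, BARRIER) and the frame. -/
theorem closes_print (hS : DyadicTowerClassicalRelations) (hC : ClassicalCongruenceJunction)
    (hW : WeightedLiftableAutomorphy) (hE : CharZero.EichlerShimuraHarder)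
    (hP : FiniteLevelTorsionSplit.PositiveDefectTorsionAutomorphy)
    (hF : FiniteLevelTorsionSplit.TorsionAvatarFrame) : _root_.Langlands :=
  CharZero.closes_print (genuine_route_iff_twin.mp (gz_of_pieces hS hC hW)) hE hP hF

/-- `closes` MODULO ALL THREE PRINT FACTS (S2T, ESW, ES) and the algebra lemma CJ: the defect-zero branch then
needs nothing but TP (positive defect, BARRIER TW/CG at ℓ = 2) and the frame. [kernel certificate] -/
theorem closes_print2 (hS : DyadicTowerClassicalRelations) (hC : ClassicalCongruenceJunction)
    (hEW : WeightedEichlerShimuraHarder) (hE : CharZero.EichlerShimuraHarder)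
    (hP : FiniteLevelTorsionSplit.PositiveDefectTorsionAutomorphy)
    (hF : FiniteLevelTorsionSplit.TorsionAvatarFrame) : _root_.Langlands :=
  CharZero.closes_print (genuine_route_iff_twin.mp (gz_of_pieces_print hS hC hEW)) hE hP hF

/-! ## Kernel IV — S2T is the `p = 2` slot of the vendored schema -/

/-- The one-parameter schema «tower relations are classical modulo nilpotence at `p`» for a tame datum `𝒰`
(the vendored fact's body with `∀ J ∃ N`). -/
def TowerClassicalRelationsAt (p : ℕ) [Fact p.Prime] (F : Type) [Field F] [NumberField F]
    (𝒰 : TameLevel 2 F p) : Prop :=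
  ∃ 𝔫 : Ideal (𝓞 F), 𝔫 ≠ 0 ∧ ∀ J : Finset (ℕ × ℕ × ℕ),
    ∃ (N e m : ℕ) (lams : Fin m → (F →+* PadicAlgCl p) → Fin 2 → ℤ) (qs : Fin m → ℕ), 0 < N ∧
      (∀ (k : Fin m) (σ σ' : F →+* PadicAlgCl p), lams k σ = lams k σ') ∧
      ∀ (r : ℕ) (ix : Fin r → HeightOneSpectrum (𝓞 F) × ℕ),
        (∀ j, (ix j).1 ∉ 𝒰.bad ∧ ¬ (ix j).1.asIdeal ∣ 𝔫 * Ideal.span {((p : ℕ) : 𝓞 F)} ^ e) →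
        ∀ Q : FreeRing (Fin r),
          (∀ k : Fin m, FreeRing.lift
            (fun j => ResGLnCohomology.heckeT (PadicAlgCl p) 2 F
              (𝔫 * Ideal.span {((p : ℕ) : 𝓞 F)} ^ e) (lams k) (qs k) (ix j).1 (ix j).2) Q = 0) →
          ∀ idx ∈ J,
            (FreeRing.lift (fun j => 𝒰.heckeOperator (heckeElement 2 F (ix j).1 (ix j).2)) Q ^ N) idx = 0

/-- S2T is VERBATIM the `p = 2` slot of the schema over all totally real `F` and all tame data. -/
theorem dyadic_iff_schema : DyadicTowerClassicalRelations ↔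
    ∀ (F : Type) [Field F] [NumberField F], NumberField.IsTotallyReal F →
      ∀ 𝒰 : TameLevel 2 F 2, TowerClassicalRelationsAt 2 F 𝒰 := Iff.rfl

/-- VERBATIM COPY of the body of the vendored named fact
`BigHeckeGLn.Scholze2015_gl2TowerHeckeRelations_classical` (`Literature/NumberTheory/Automorphic/
GL2TowerTorsionRelationsClassical.lean`, lines 318–334 @ tree 2026-08-17); the identity with the Literature
constant is `Iff.rfl` (companion file `ClassicalCongruenceSplit.Vendored.lean`, to be checked once the farm
has that module built — it was reported `unbuilt` on 2026-08-31T00:2xZ).  Inlined so that THIS file's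
certificate `schema_of_vendoredText` is kernel-checked today. -/
def VendoredScholze2015Text : Prop :=
  ∀ (F : Type) [Field F] [NumberField F], NumberField.IsTotallyReal F →
  ∀ (p : ℕ) [Fact p.Prime], 5 ≤ p → ¬ ((p : ℤ) ∣ NumberField.discr F) →
  ∀ (𝒰 : TameLevel 2 F p),
  ∃ 𝔫 : Ideal (𝓞 F), 𝔫 ≠ 0 ∧ ∃ N : ℕ, 0 < N ∧
  ∀ J : Finset (ℕ × ℕ × ℕ),
  ∃ (e m : ℕ) (lams : Fin m → (F →+* PadicAlgCl p) → Fin 2 → ℤ) (qs : Fin m → ℕ),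
    (∀ (k : Fin m) (τ τ' : F →+* PadicAlgCl p), lams k τ = lams k τ') ∧
    ∀ (r : ℕ) (ix : Fin r → HeightOneSpectrum (𝓞 F) × ℕ),
      (∀ j, (ix j).1 ∉ 𝒰.bad ∧ ¬ (ix j).1.asIdeal ∣ 𝔫 * Ideal.span {((p : ℕ) : 𝓞 F)} ^ e) →
      ∀ Q : FreeRing (Fin r),
        (∀ k : Fin m, FreeRing.lift
          (fun j => ResGLnCohomology.heckeT (PadicAlgCl p) 2 F
            (𝔫 * Ideal.span {((p : ℕ) : 𝓞 F)} ^ e) (lams k) (qs k) (ix j).1 (ix j).2) Q = 0) →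
        ∀ idx ∈ J,
          (FreeRing.lift (fun j => 𝒰.heckeOperator (heckeElement 2 F (ix j).1 (ix j).2)) Q ^ N)
            idx = 0

/-- The VENDORED fact (inlined text) proves every `p ≥ 5`, `p ∤ disc F` slot of the schema (weakening
`∃ N ∀ J` to `∀ J ∃ N`); S2T is the `p = 2` slot (`dyadic_iff_schema`). [kernel certificate] -/
theorem schema_of_vendoredText (h : VendoredScholze2015Text) (p : ℕ) [Fact p.Prime]
    (hp : 5 ≤ p) (F : Type) [Field F] [NumberField F] (hF : NumberField.IsTotallyReal F)
    (hd : ¬ ((p : ℤ) ∣ NumberField.discr F)) (𝒰 : TameLevel 2 F p) : TowerClassicalRelationsAt p F 𝒰 := by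
  obtain ⟨𝔫, h𝔫, N, hN, hJ⟩ := h F hF p hp hd 𝒰
  refine ⟨𝔫, h𝔫, fun J => ?_⟩
  obtain ⟨e, m, lams, qs, hpar, hrel⟩ := hJ J
  exact ⟨N, e, m, lams, qs, hN, hpar, hrel⟩

end Summit.Langlands.Langlands.Theorems.LevelOneDyadic.Classical
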